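import Literature.Computability.QuantumComplexity.PolyCopies
import Literature.Computability.QuantumComplexity.RevCleanPoly
import HarnessLib

/-!
# Regev's per-copy routine as a circuit family, I: parameters and layout

Topic `Algebra/EuclideanLattices` (family `pqc`); first file of the circuit-level construction
towards the discharge of `Literature.Algebra.EuclideanLattices.usvp_of_dihedralCoset` (O. Regev,
*Quantum computation and lattice problems*, SIAM J. Comput. 33 (2004), Thm. 1.1: a solution of
the dihedral coset problem yields a quantum algorithm for `Θ(n^{1/2+2f})`-unique-SVP). No named
fact is introduced.

Regev's algorithm (proof of Lemma 3.12, p. 14) prepares `r` registers, each by the routine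
"uniform superposition over `(t, ā)` and over the grid points `x̄` of a ball; add `f(t, ā)` to
the last register; measure it", feeds them to the DCP/two-point solver, and classically
post-processes. In the tree's model (poly-time uniform, oracle-free Clifford+T families measured
once at the end, `QCircuitFamily`) the routine becomes ONE circuit per input length `L`:
Hadamard coins; a classical reversible program moving, for every register `k < r_max`, the coins
`J = (ix, tā)` into a work area, running two garbage-free blocks `W` (computing the measured
value `y` from `J`, the input and the guesses) and `V` (recomputing from `y` what must be
erased), erasing by `CNOT`s from the plain-bit wires of `V`'s result, running `V` again (a clean
block applied twice is the identity), routing `(t, ā)` into register slot `k` of the solver's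
block and the code of `y` into a garbage zone; then the solver's circuit, verbatim, on the front
block. This file fixes the **parameters** (a hypothesis structure `Params`: the solver family and
its size bounds, the two block machines with their functions and time exponents, the coin-zone
polynomials) and the **layout** (all zone sizes are explicit functions of `L`; positions inside
the solver block are exact in `n = L − ⌊√L⌋²`, every other offset is a polynomial quantity of
`L`), with the size bookkeeping consumed by the sequels (programs and semantics, quantum
semantics, uniformity).

## Layout (wire indices of the circuit on inputs of length `L`)

* `[0, bS L)` — the solver zone: `encodeNat N` on `[0, ell n)`, slot `k` on
  `[ell n + k (ell n + 1), ell n + (k+1)(ell n + 1))`, `n = nOf L`, `ell n = n(4n+1)+1`;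
* from `A0 L = bS L + L` on, consecutively: `U` (`L+1`), `ix` (`kap L`), `U₂` (`L+1`),
  `ta` (`sig L = ell L + 1`), `wz` (`L`, the parked input), `gz` (`gam L`), `Z` (`zet L`),
  then the work and result wires of `W` (the block `W` occupies `[A0 L, A0 L + widthW L)` with
  data length `n0W L`), then those of `V` (`V` occupies `[oV L, oV L + widthV L)`,
  `oV L = A0 L + (L+1) + kap L`, data length `n0V L`), the mask zone `T` (`sig L`), then the
  coin zones `C k` (`kap L + sig L` each), the garbage zones `G k` (`copyN` of `W` each) and the
  mask garbage zones `GT k` (`sig L` each), `k < rmax L`.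

## References

* O. Regev, *Quantum computation and lattice problems*, SIAM J. Comput. 33 (2004) 738–760,
  proof of Lemma 3.12 (p. 14), proof of Thm. 1.1 (p. 7).
* C. H. Bennett, *Logical reversibility of computation*, IBM J. Res. Develop. 17 (1973), §2.
* M. A. Nielsen, I. L. Chuang, *Quantum Computation and Quantum Information*, CUP 2010, §3.2.5,
  §4.4.
-/

noncomputable section

namespace Literature.Algebra.EuclideanLattices

namespace RegevRoutine

open _root_.Computability Literature.Computability.Complexity Literature.Computability.Cryptography
  Literature.Computability.QuantumComplexity Turing RevSim RevClean Polynomial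

/-! ### Parameters -/

/-- The data of the routine (a hypothesis structure). `FD` is the given solver family with a
polynomial bound `pD` of its width and `pr` of its register count; `MW`, `MV` are machines of the
two block functions `fW`, `fV` with time exponents `eW`, `eV`; `pkap`, `pgam` are the polynomials
sizing the coin zones. [cite: Regev2004, Lemma 3.12 (proof, p. 14: the routine creating one register)] -/
structure Params where
  /-- the solver family (a DCP solver) -/
  FD : QCircuitFamily cliffordT
  /-- a polynomial bound of its width: `ℓ + FD.ancillas ℓ ≤ pD(ℓ)` -/
  pD : Polynomial ℕ
  /-- the bound -/
  hpD : ∀ ℓ, ℓ + FD.ancillas ℓ ≤ pD.eval ℓ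
  /-- a polynomial bound of the number of registers, in terms of `ℓ` -/
  pr : Polynomial ℕ
  /-- the function of the first block -/
  fW : List Bool → List Bool
  /-- its time exponent -/
  eW : ℕ
  /-- its machine -/
  MW : TM2ComputableAux Bool Bool
  /-- the machine computes `fW` within `(n+2)^eW` steps on every input -/
  hMW : ∀ u, MW.OutputsWithin u (fW u) (Tn eW u.length)
  /-- the function of the second block -/
  fV : List Bool → List Bool
  /-- its time exponent -/
  eV : ℕ
  /-- its machine -/
  MV : TM2ComputableAux Bool Bool
  /-- the machine computes `fV` within `(n+2)^eV` steps on every input -/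
  hMV : ∀ u, MV.OutputsWithin u (fV u) (Tn eV u.length)
  /-- the size of the index coin field `ix`, a polynomial of `L` -/
  pkap : Polynomial ℕ
  /-- the size of the guess coin zone `gz`, a polynomial of `L` -/
  pgam : Polynomial ℕ

variable (P : Params)

/-! ### Arithmetic of the instance -/

/-- The lattice dimension coded in the input length: `n = L − ⌊√L⌋²`. [folklore] -/
def nOf (L : ℕ) : ℕ := L - Nat.sqrt L ^ 2

/-- The DCP input length `ℓ(n) = n(4n+1) + 1` (`N = 2^{ℓ−1} = (2M)ⁿ`, `M = 2^{4n}`).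
[cite: Regev2004, Lemma 3.2 (N = (2M)^n) and Lemma 3.12 (M = 2^{4n})] -/
def ell (n : ℕ) : ℕ := n * (4 * n + 1) + 1

/-- The width of one register slot: a control bit and `ℓ` data bits. [cite: Regev2004, Def. 2.1 (1 + ⌈log N⌉ qubits)] -/
def slotW (n : ℕ) : ℕ := ell n + 1

/-- `nOf L ≤ L`. [folklore] -/
theorem nOf_le (L : ℕ) : nOf L ≤ L := Nat.sub_le _ _

/-- `ell` is monotone. [folklore] -/
theorem ell_mono {a b : ℕ} (h : a ≤ b) : ell a ≤ ell b := by
  unfold ell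
  have : a * (4 * a + 1) ≤ b * (4 * b + 1) := Nat.mul_le_mul h (by omega)
  omega

/-! ### Sizes as functions of the input length -/

/-- The number of register slots prepared: `rmax L = pr(ell L) + 1`. [folklore] -/
def rmax (L : ℕ) : ℕ := P.pr.eval (ell L) + 1

/-- The solver zone: room for the solver's wires on `ℓ ≤ ell L` and for `rmax L` slots. [folklore] -/
def bS (L : ℕ) : ℕ := P.pD.eval (ell L) + ell L + rmax P L * slotW L

/-- The index coin field. [folklore] -/
def kap (L : ℕ) : ℕ := P.pkap.eval L

/-- The `(t, ā)` coin field: one slot width at `n = L`. [folklore] -/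
def sig (L : ℕ) : ℕ := slotW L

/-- The guess coin zone. [folklore] -/
def gam (L : ℕ) : ℕ := P.pgam.eval L

/-- The unary iteration counter zone. [folklore] -/
def zet (L : ℕ) : ℕ := rmax P L + 1

/-- The base of the data area. [folklore] -/
def A0 (L : ℕ) : ℕ := bS P L + L

/-- Offset of `U`. [folklore] -/
def oU (L : ℕ) : ℕ := A0 P L
/-- Offset of `ix`. [folklore] -/
def oIx (L : ℕ) : ℕ := oU P L + (L + 1)
/-- Offset of `U₂` (the start of the block `V`). [folklore] -/
def oV (L : ℕ) : ℕ := oIx P L + kap P L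
/-- Offset of `ta`. [folklore] -/
def oTa (L : ℕ) : ℕ := oV P L + (L + 1)
/-- Offset of the parked input `wz`. [folklore] -/
def oWz (L : ℕ) : ℕ := oTa P L + sig L
/-- Offset of the guess zone `gz`. [folklore] -/
def oGz (L : ℕ) : ℕ := oWz P L + L
/-- Offset of the counter zone `Z`. [folklore] -/
def oZ (L : ℕ) : ℕ := oGz P L + gam P L

/-- Data length of the block `W`: `U ix U₂ ta wz gz Z`. [folklore] -/
def n0W (L : ℕ) : ℕ := (L + 1) + kap P L + (L + 1) + sig L + L + gam P L + zet P L

/-- The end of the data of `W` is `A0 + n0W`. [folklore] -/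
theorem oZ_add_zet (L : ℕ) : oZ P L + zet P L = A0 P L + n0W P L := by
  unfold oZ oGz oWz oTa oV oIx oU n0W; omega

/-- Width of the block `W`. [folklore] -/
def widthW (L : ℕ) : ℕ := RevClean.width P.eW P.MW (n0W P L)

/-- Tableau wires of `W` (data + work, before the result wires). [folklore] -/
def NNW (L : ℕ) : ℕ := NN P.eW P.MW (n0W P L)

/-- Number of result wires of `W` (the size of one garbage zone). [folklore] -/
def copyW (L : ℕ) : ℕ := copyN P.eW P.MW (n0W P L)

/-- Data length of the block `V`: from `U₂` to the end of `W`. [folklore] -/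
def n0V (L : ℕ) : ℕ := A0 P L + widthW P L - oV P L

/-- Width of the block `V`. [folklore] -/
def widthV (L : ℕ) : ℕ := RevClean.width P.eV P.MV (n0V P L)

/-- Tableau wires of `V`. [folklore] -/
def NNV (L : ℕ) : ℕ := NN P.eV P.MV (n0V P L)

/-- Number of output cells of `V` that are erased from: `kap + sig`. [folklore] -/
def eraseN (L : ℕ) : ℕ := kap P L + sig L

/-- Offset of the mask zone `T` (end of the block `V`): receives the erase mask of `ta` so that
`ta` itself, part of the data of `V`, is only modified after the second copy of `V`. [folklore] -/
def oT (L : ℕ) : ℕ := oV P L + widthV P L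

/-- Base of the coin zones (after the mask zone). [folklore] -/
def cBase (L : ℕ) : ℕ := oT P L + sig L

/-- Width of one coin zone: `ix` and `ta` fields. [folklore] -/
def cW (L : ℕ) : ℕ := kap P L + sig L

/-- Offset of coin zone `k`. [folklore] -/
def oC (L k : ℕ) : ℕ := cBase P L + k * cW P L

/-- Base of the garbage zones. [folklore] -/
def gBase (L : ℕ) : ℕ := cBase P L + rmax P L * cW P L

/-- Offset of garbage zone `k`. [folklore] -/
def oG (L k : ℕ) : ℕ := gBase P L + k * copyW P L

/-- Base of the mask garbage zones. [folklore] -/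
def gtBase (L : ℕ) : ℕ := gBase P L + rmax P L * copyW P L

/-- Offset of mask garbage zone `k` (width `sig L`). [folklore] -/
def oGT (L k : ℕ) : ℕ := gtBase P L + k * sig L

/-- The total number of wires. [folklore] -/
def Wtot (L : ℕ) : ℕ := gtBase P L + rmax P L * sig L

/-- The number of ancillas. [folklore] -/
def anc (L : ℕ) : ℕ := Wtot P L - L

/-- Slot `k` of the solver block starts at `ell n + k (ell n + 1)`. [cite: Regev2004, Def. 2.1 (the registers of the DCP input)] -/
def oSlot (n k : ℕ) : ℕ := ell n + k * slotW n

/-! ### Size bookkeeping -/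

section Sizes

variable {P}

/-- `n0W ≤ NNW`. [folklore] -/
theorem n0W_le_NNW (L : ℕ) : n0W P L ≤ NNW P L := le_NN _
/-- `NNW ≤ widthW`. [folklore] -/
theorem NNW_le_widthW (L : ℕ) : NNW P L ≤ widthW P L := NN_le_width _
/-- `widthW = NNW + copyW`. [folklore] -/
theorem widthW_eq (L : ℕ) : widthW P L = NNW P L + copyW P L := rfl
/-- `n0V ≤ NNV`. [folklore] -/
theorem n0V_le_NNV (L : ℕ) : n0V P L ≤ NNV P L := le_NN _
/-- `NNV ≤ widthV`. [folklore] -/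
theorem NNV_le_widthV (L : ℕ) : NNV P L ≤ widthV P L := NN_le_width _

/-- The data of `V` ends where `W` ends. [folklore] -/
theorem oV_add_n0V (L : ℕ) : oV P L + n0V P L = A0 P L + widthW P L := by
  have h1 : oV P L ≤ A0 P L + n0W P L := by rw [← oZ_add_zet]; unfold oZ oGz oWz oTa; omega
  have h2 : n0W P L ≤ widthW P L := (n0W_le_NNW L).trans (NNW_le_widthW L)
  unfold n0V; omega

/-- Ordering of the offsets of the data area. [folklore] -/
theorem offsets_chain (L : ℕ) :
    L ≤ A0 P L ∧ bS P L ≤ A0 P L ∧ A0 P L = oU P L ∧ oU P L + (L + 1) = oIx P L ∧ oIx P L + kap P L = oV P L ∧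
      oV P L + (L + 1) = oTa P L ∧ oTa P L + sig L = oWz P L ∧ oWz P L + L = oGz P L ∧
      oGz P L + gam P L = oZ P L ∧ oZ P L + zet P L = A0 P L + n0W P L ∧
      A0 P L + n0W P L ≤ A0 P L + NNW P L ∧ A0 P L + NNW P L + copyW P L = A0 P L + widthW P L ∧
      A0 P L + widthW P L = oV P L + n0V P L ∧ oV P L + n0V P L ≤ oV P L + NNV P L ∧
      oV P L + NNV P L ≤ oT P L ∧ oT P L + sig L = cBase P L ∧ cBase P L + rmax P L * cW P L = gBase P L ∧
      gBase P L + rmax P L * copyW P L = gtBase P L ∧ gtBase P L + rmax P L * sig L = Wtot P L := by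
  refine ⟨by unfold A0; omega, by unfold A0; omega, rfl, rfl, rfl, rfl, rfl, rfl, rfl, oZ_add_zet P L,
    Nat.add_le_add_left (n0W_le_NNW L) _, by rw [widthW_eq]; omega, (oV_add_n0V L).symm,
    Nat.add_le_add_left (n0V_le_NNV L) _, ?_, rfl, rfl, rfl, rfl⟩
  unfold oT; exact Nat.add_le_add_left (NNV_le_widthV L) _

/-- `L ≤ Wtot`. [folklore] -/
theorem le_Wtot (L : ℕ) : L ≤ Wtot P L := by
  have h := offsets_chain (P := P) L
  omega

/-- `L + anc L = Wtot L`. [folklore] -/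
theorem add_anc (L : ℕ) : L + anc P L = Wtot P L := by
  have := le_Wtot (P := P) L; unfold anc; omega

/-- Coin zone `k < rmax` lies below `gBase`. [folklore] -/
theorem oC_add_cW_le {L k : ℕ} (hk : k < rmax P L) : oC P L k + cW P L ≤ gBase P L := by
  unfold oC gBase
  have : (k + 1) * cW P L ≤ rmax P L * cW P L := Nat.mul_le_mul_right _ hk
  rw [Nat.add_mul, Nat.one_mul] at this
  omega

/-- Garbage zone `k < rmax` lies below `gtBase`. [folklore] -/
theorem oG_add_copyW_le {L k : ℕ} (hk : k < rmax P L) : oG P L k + copyW P L ≤ gtBase P L := by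
  unfold oG gtBase
  have : (k + 1) * copyW P L ≤ rmax P L * copyW P L := Nat.mul_le_mul_right _ hk
  rw [Nat.add_mul, Nat.one_mul] at this
  omega

/-- Mask garbage zone `k < rmax` lies below `Wtot`. [folklore] -/
theorem oGT_add_sig_le {L k : ℕ} (hk : k < rmax P L) : oGT P L k + sig L ≤ Wtot P L := by
  unfold oGT Wtot
  have : (k + 1) * sig L ≤ rmax P L * sig L := Nat.mul_le_mul_right _ hk
  rw [Nat.add_mul, Nat.one_mul] at this
  omega

/-- Distinct mask garbage zones are disjoint. [folklore] -/
theorem oGT_add_sig_le_oGT {L k k' : ℕ} (h : k < k') : oGT P L k + sig L ≤ oGT P L k' := by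
  unfold oGT
  have : (k + 1) * sig L ≤ k' * sig L := Nat.mul_le_mul_right _ h
  rw [Nat.add_mul, Nat.one_mul] at this
  omega

/-- `gtBase ≤ oGT k`. [folklore] -/
theorem gtBase_le_oGT (L k : ℕ) : gtBase P L ≤ oGT P L k := Nat.le_add_right _ _

/-- Slot `k < rmax` at dimension `n ≤ L` lies inside the solver zone. [folklore] -/
theorem oSlot_add_slotW_le {L n k : ℕ} (hn : n ≤ L) (hk : k < rmax P L) : oSlot n k + slotW n ≤ bS P L := by
  unfold oSlot bS
  have h1 : ell n ≤ ell L := ell_mono hn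
  have h2 : slotW n ≤ slotW L := by unfold slotW; omega
  have h3 : (k + 1) * slotW n ≤ rmax P L * slotW L := Nat.mul_le_mul hk h2
  rw [Nat.add_mul, Nat.one_mul] at h3
  omega

/-- The solver's wires at `ℓ = ell n`, `n ≤ L`, fit into the solver zone. [folklore] -/
theorem solver_fits {L n : ℕ} (hn : n ≤ L) : ell n + P.FD.ancillas (ell n) ≤ bS P L := by
  have h1 := P.hpD (ell n)
  have h2 : P.pD.eval (ell n) ≤ P.pD.eval (ell L) := TM2Iter.eval_mono _ (ell_mono hn)
  unfold bS; omega

/-- Distinct slots are disjoint (as intervals): `oSlot n k + slotW n ≤ oSlot n k'` for `k < k'`. [folklore] -/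
theorem oSlot_add_slotW_le_oSlot {n k k' : ℕ} (h : k < k') : oSlot n k + slotW n ≤ oSlot n k' := by
  unfold oSlot
  have : (k + 1) * slotW n ≤ k' * slotW n := Nat.mul_le_mul_right _ h
  rw [Nat.add_mul, Nat.one_mul] at this
  omega

/-- `ell n ≤ oSlot n k`. [folklore] -/
theorem ell_le_oSlot (n k : ℕ) : ell n ≤ oSlot n k := Nat.le_add_right _ _

/-- Distinct coin zones are disjoint. [folklore] -/
theorem oC_add_cW_le_oC {L k k' : ℕ} (h : k < k') : oC P L k + cW P L ≤ oC P L k' := by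
  unfold oC
  have : (k + 1) * cW P L ≤ k' * cW P L := Nat.mul_le_mul_right _ h
  rw [Nat.add_mul, Nat.one_mul] at this
  omega

/-- Distinct garbage zones are disjoint. [folklore] -/
theorem oG_add_copyW_le_oG {L k k' : ℕ} (h : k < k') : oG P L k + copyW P L ≤ oG P L k' := by
  unfold oG
  have : (k + 1) * copyW P L ≤ k' * copyW P L := Nat.mul_le_mul_right _ h
  rw [Nat.add_mul, Nat.one_mul] at this
  omega

/-- `cBase ≤ oC k`. [folklore] -/
theorem cBase_le_oC (L k : ℕ) : cBase P L ≤ oC P L k := Nat.le_add_right _ _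

/-- `gBase ≤ oG k`. [folklore] -/
theorem gBase_le_oG (L k : ℕ) : gBase P L ≤ oG P L k := Nat.le_add_right _ _

end Sizes

end RegevRoutine

end Literature.Algebra.EuclideanLattices

end
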